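/-
Copyright (c) 2026 the pub-hodgecm-mathlib formalisation cell (harness21).  Prover seat hodgecm-mathlib-K2E4-p11 (g9): Track B «K2-LIT»,
hLiu418 = stmt-HodgeConjecture-24832, socket #41 KIND W, organ «Φ6b-ind» FILE 4 (LEAD F0P6-plan (g14) BATCH #178 (1), KW desk F0P2-p08 (g3)):
ANALYTIC CONTINUATION OF SHIMURA's ξ ON `Herm₂(ℂ)` ALONG THE DIAGONAL AT EVERY NON-DEGENERATE INDEX (definite or INDEFINITE) —
from the ★ Cayley recursion (FILE 3b) by induction.  THEOREMS ONLY (no `def`, no `instance`, no `notation`, no named-fact hypothesis, no `sorry`).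
-/
import Summits.HodgeConjecture.HodgeConjecture.Theorems.K2LiuHermTwoXiCayleyRecursion        -- ★ FILE 3b (this seat): the Cayley recursion
import Summits.HodgeConjecture.HodgeConjecture.Theorems.K2LiuHermTwoConfluentXiHolomorphy     -- ★ holomorphy of ξ on the half-space of convergence
import HarnessLib

/-!
# Crux `HLiu418`, ROAD Φ ∕ KIND W organ «Φ6b-ind», FILE 4: CONTINUATION of `s ↦ ξ(g, h; a + s, b + s)` at every index with `det h ≠ 0`

Cell `hodgecm-mathlib`, crux item hLiu418 = `stmt-HodgeConjecture-24832` (helper lane `--supports … --as helper`, count-neutral), route of record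
`HCCMUnconditional`; squad K2 ∕ K2Liu, road `K2_Liu`, socket #41, KIND W.  Sequel of ★ FILE 3b `K2LiuHermTwoXiCayleyRecursion`.

WHAT.  For `g > 0`, `h` Hermitian with `det h ≠ 0` — signature `(2,0)`, `(0,2)` OR `(1,1)` — and any base point `(a, b) ∈ ℂ²`:
* `xiTwo_eq_of_det_ne_zero` — the ★ Cayley recursion SOLVED for `ξ(α, β)` on `{re(α+β) > 3}`:
  `ξ(α,β) = (−4π² det h)⁻¹·((α+β−1)(α ξ(α+1,β) + β ξ(α,β+1)) + 4αβ det(g) ξ(α+1,β+1))`;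
* `exists_continuation_xiTwo_diag` — for every `N : ℕ` there is `F` HOLOMORPHIC on the half-plane `{s | 3 − N < re(a + b + 2s)}` with
  `F s = ξ(g, h; a + s, b + s)` on the half-plane of absolute convergence `{s | 3 < re(a + b + 2s)}` (induction on `N`: the right-hand side
  of the solved recursion only involves `ξ` with `α + β` raised by `1` or `2`; base ★ `differentiableOn_xiTwo_diag`);
* `exists_continuation_xiTwo_diag_rightHalfPlane` — in particular ONE `F` holomorphic on `{0 < re s}` (the half-plane of the KIND-W letters),
  whatever `(a, b)`: the `∃ F, DifferentiableOn ℂ F {0 < re s} ∧ F = ξ on the abscissa` BYTES of the per-place archimedean Whittaker letter at an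
  INDEFINITE framed index.
This is the CONTINUATION HALF of [Shimura1982, Thm. 3.1 ∕ §4 Thm. 4.2] for `n = 2` at non-degenerate `h` of every signature, obtained
here on the ξ-side without the η-representation (which at indefinite `h` is [Shimura1982, §4]).  The GROWTH half (decay in `h`, polynomial
growth in `im s`) below `re α = 1` is NOT proved here and stays OPEN (Shimura §4).
[Shimura1982, §3 (3.4)–(3.7), Thm. 3.1; §4 Thm. 4.2] [Shimura1997, §16.4–16.5].
HONEST LABEL.  Count-neutral helper of the K2_Liu road; it pays no socket by itself: `HC_CM` is proved only modulo the 7 printed citations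
(2 remaining named inputs: hLiu418 = `stmt-HodgeConjecture-24832`, h413 = `stmt-HodgeConjecture-24833`) until rung 0 closes.

## References
* [Shimura1982] G. Shimura, *Confluent hypergeometric functions on tube domains*, Math. Ann. 260 (1982) 269–302: §3 Thm. 3.1, §4 Thm. 4.2.
* [Shimura1997] G. Shimura, *Euler Products and Eisenstein Series*, CBMS 93 (1997): §16.4–16.5.
-/

set_option autoImplicit false
-- the mandated namespace repeats the single-problem summit's segment (`HodgeConjecture.HodgeConjecture`)
set_option linter.dupNamespace false

noncomputable section

open Complex MeasureTheory Set
open scoped ComplexOrder ComplexConjugate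

namespace Summit.HodgeConjecture.HodgeConjecture.Cruxes.HLiu418.K2LiuHermTwoXiIndefiniteContinuation

open Summit.HodgeConjecture.HodgeConjecture.Cruxes.HLiu418.K2LiuHermTwoGammaDefs
open Summit.HodgeConjecture.HodgeConjecture.Cruxes.HLiu418.K2LiuHermTwoConfluentXiDefs
open Summit.HodgeConjecture.HodgeConjecture.Cruxes.HLiu418.K2LiuHermTwoConfluentXiConvergence
open Summit.HodgeConjecture.HodgeConjecture.Cruxes.HLiu418.K2LiuHermTwoConfluentXiHolomorphy
open Summit.HodgeConjecture.HodgeConjecture.Cruxes.HLiu418.K2LiuHermTwoXiCayleyRecursion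

variable {g h : Matrix (Fin 2) (Fin 2) ℂ} {α β : ℂ}

/-- `−4π²·det h ≠ 0` for a non-degenerate `h`. -/
theorem cayleyConstant_ne_zero (hdet : h.det ≠ 0) : (-(4 * (Real.pi : ℂ) ^ 2) * h.det) ≠ 0 :=
  mul_ne_zero (neg_ne_zero.mpr (mul_ne_zero (by norm_num) (pow_ne_zero _ (Complex.ofReal_ne_zero.mpr Real.pi_ne_zero)))) hdet

/-- **THE ★ CAYLEY RECURSION SOLVED FOR `ξ(α, β)`** at a non-degenerate index: for `g > 0`, `h` Hermitian with `det h ≠ 0`, `re(α+β) > 3`,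
`ξ(α,β) = (−4π² det h)⁻¹·((α+β−1)(α ξ(α+1,β) + β ξ(α,β+1)) + 4αβ det(g) ξ(α+1,β+1))`. [cite: Shimura1982, §3 Thm. 3.1] -/
theorem xiTwo_eq_of_det_ne_zero (hg : g.PosDef) (hh : h.IsHermitian) (hdet : h.det ≠ 0) (hαβ : 3 < (α + β).re) :
    xiTwo g h α β = (-(4 * (Real.pi : ℂ) ^ 2) * h.det)⁻¹ *
      ((α + β - 1) * (α * xiTwo g h (α + 1) β + β * xiTwo g h α (β + 1)) + 4 * α * β * g.det * xiTwo g h (α + 1) (β + 1)) := by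
  rw [← xiTwo_cayley_recursion hg hh hαβ, ← mul_assoc, inv_mul_cancel₀ (cayleyConstant_ne_zero hdet), one_mul]

/-- **ANALYTIC CONTINUATION OF `s ↦ ξ(g, h; a + s, b + s)` AT EVERY NON-DEGENERATE INDEX** (organ «Φ6b-ind», continuation half of
[Shimura1982, Thm. 3.1 ∕ Thm. 4.2] for `n = 2`, signature-free): for `g > 0`, `h` Hermitian with `det h ≠ 0` (definite OR indefinite), every
`N : ℕ` and `a b : ℂ`, there is `F : ℂ → ℂ` HOLOMORPHIC on the half-plane `{s | 3 − N < re(a + b + 2s)}` that equals `ξ(g, h; a + s, b + s)`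
on the half-plane of absolute convergence `{s | 3 < re(a + b + 2s)}`.  Induction on `N` through the ★ Cayley recursion
(`F_{N+1} = (−4π² det h)⁻¹·((a+b+2s−1)((a+s)F_N^{(a+1,b)} + (b+s)F_N^{(a,b+1)}) + 4(a+s)(b+s)det(g)F_N^{(a+1,b+1)})`).
[cite: Shimura1982, §3 Thm. 3.1, §4 Thm. 4.2] [cite: Shimura1997, §16.5] -/
theorem exists_continuation_xiTwo_diag (hg : g.PosDef) (hh : h.IsHermitian) (hdet : h.det ≠ 0) (N : ℕ) (a b : ℂ) :
    ∃ F : ℂ → ℂ, DifferentiableOn ℂ F {s : ℂ | 3 - (N : ℝ) < (a + b + 2 * s).re} ∧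
      ∀ s : ℂ, 3 < (a + b + 2 * s).re → F s = xiTwo g h (a + s) (b + s) := by
  induction N generalizing a b with
  | zero =>
    refine ⟨fun s => xiTwo g h (a + s) (b + s), ?_, fun s _ => rfl⟩
    simp only [Nat.cast_zero, sub_zero]
    exact differentiableOn_xiTwo_diag hg hh a b
  | succ N ih =>
    obtain ⟨F₁, hF₁d, hF₁⟩ := ih (a + 1) b
    obtain ⟨F₂, hF₂d, hF₂⟩ := ih a (b + 1)
    obtain ⟨F₃, hF₃d, hF₃⟩ := ih (a + 1) (b + 1)
    refine ⟨fun s => (-(4 * (Real.pi : ℂ) ^ 2) * h.det)⁻¹ *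
        ((a + s + (b + s) - 1) * ((a + s) * F₁ s + (b + s) * F₂ s) + 4 * (a + s) * (b + s) * g.det * F₃ s), ?_, fun s hs => ?_⟩
    · -- holomorphy on `{3 − (N+1) < re(a+b+2s)}`: the three continuations live on larger half-planes
      have hsub1 : {s : ℂ | 3 - ((N + 1 : ℕ) : ℝ) < (a + b + 2 * s).re} ⊆ {s : ℂ | 3 - (N : ℝ) < (a + 1 + b + 2 * s).re} := fun s hs => by
        simp only [mem_setOf_eq, add_re, one_re, Nat.cast_add, Nat.cast_one] at hs ⊢
        linarith
      have hsub2 : {s : ℂ | 3 - ((N + 1 : ℕ) : ℝ) < (a + b + 2 * s).re} ⊆ {s : ℂ | 3 - (N : ℝ) < (a + (b + 1) + 2 * s).re} := fun s hs => by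
        simp only [mem_setOf_eq, add_re, one_re, Nat.cast_add, Nat.cast_one] at hs ⊢
        linarith
      have hsub3 : {s : ℂ | 3 - ((N + 1 : ℕ) : ℝ) < (a + b + 2 * s).re} ⊆ {s : ℂ | 3 - (N : ℝ) < (a + 1 + (b + 1) + 2 * s).re} := fun s hs => by
        simp only [mem_setOf_eq, add_re, one_re, Nat.cast_add, Nat.cast_one] at hs ⊢
        linarith
      have hla : Differentiable ℂ (fun s : ℂ => a + s) := differentiable_id.const_add a
      have hlb : Differentiable ℂ (fun s : ℂ => b + s) := differentiable_id.const_add b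
      have hl1 : Differentiable ℂ (fun s : ℂ => a + s + (b + s) - 1) := (hla.add hlb).sub_const 1
      have hq : Differentiable ℂ (fun s : ℂ => 4 * (a + s) * (b + s) * g.det) := (((differentiable_const _).mul hla).mul hlb).mul_const _
      exact (differentiableOn_const _).mul (((hl1.differentiableOn).mul (((hla.differentiableOn).mul (hF₁d.mono hsub1)).add
        ((hlb.differentiableOn).mul (hF₂d.mono hsub2)))).add ((hq.differentiableOn).mul (hF₃d.mono hsub3)))
    · -- the solved recursion on `{3 < re(a+b+2s)}`
      have hs1 : 3 < (a + 1 + b + 2 * s).re := by simp only [add_re, one_re] at hs ⊢; linarith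
      have hs2 : 3 < (a + (b + 1) + 2 * s).re := by simp only [add_re, one_re] at hs ⊢; linarith
      have hs3 : 3 < (a + 1 + (b + 1) + 2 * s).re := by simp only [add_re, one_re] at hs ⊢; linarith
      have hαβ : 3 < (a + s + (b + s)).re := by
        have e : a + s + (b + s) = a + b + 2 * s := by ring
        rw [e]
        exact hs
      have e1 : a + 1 + s = a + s + 1 := by ring
      have e2 : b + 1 + s = b + s + 1 := by ring
      simp only
      rw [hF₁ s hs1, hF₂ s hs2, hF₃ s hs3, e1, e2]
      exact (xiTwo_eq_of_det_ne_zero hg hh hdet hαβ).symm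

/-- **THE CONTINUATION BYTES ON THE RIGHT HALF-PLANE** (the half-plane of the KIND-W letters): for `g > 0`, `h` Hermitian with `det h ≠ 0` and any
`a b : ℂ` there is ONE `F` holomorphic on `{s | 0 < re s}` with `F s = ξ(g, h; a + s, b + s)` whenever `re(a + b + 2s) > 3`
(`exists_continuation_xiTwo_diag` with `N = ⌈3 − re(a+b)⌉₊`). [cite: Shimura1982, §4 Thm. 4.2] -/
theorem exists_continuation_xiTwo_diag_rightHalfPlane (hg : g.PosDef) (hh : h.IsHermitian) (hdet : h.det ≠ 0) (a b : ℂ) :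
    ∃ F : ℂ → ℂ, DifferentiableOn ℂ F {s : ℂ | 0 < s.re} ∧ ∀ s : ℂ, 3 < (a + b + 2 * s).re → F s = xiTwo g h (a + s) (b + s) := by
  obtain ⟨F, hFd, hF⟩ := exists_continuation_xiTwo_diag hg hh hdet ⌈3 - (a + b).re⌉₊ a b
  refine ⟨F, hFd.mono fun s hs => ?_, hF⟩
  have hceil : 3 - (a + b).re ≤ (⌈3 - (a + b).re⌉₊ : ℝ) := Nat.le_ceil _
  simp only [mem_setOf_eq, add_re, two_mul] at hs hceil ⊢
  linarith

/-- The same continuation bytes on ANY right half-plane `{s | c < re s}` (e.g. a strip around the unitary axis), `c : ℝ`. -/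
theorem exists_continuation_xiTwo_diag_halfPlane (hg : g.PosDef) (hh : h.IsHermitian) (hdet : h.det ≠ 0) (a b : ℂ) (c : ℝ) :
    ∃ F : ℂ → ℂ, DifferentiableOn ℂ F {s : ℂ | c < s.re} ∧ ∀ s : ℂ, 3 < (a + b + 2 * s).re → F s = xiTwo g h (a + s) (b + s) := by
  obtain ⟨F, hFd, hF⟩ := exists_continuation_xiTwo_diag hg hh hdet ⌈3 - (a + b).re - 2 * c⌉₊ a b
  refine ⟨F, hFd.mono fun s hs => ?_, hF⟩
  have hceil : 3 - (a + b).re - 2 * c ≤ (⌈3 - (a + b).re - 2 * c⌉₊ : ℝ) := Nat.le_ceil _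
  simp only [mem_setOf_eq, add_re, two_mul] at hs hceil ⊢
  linarith

end Summit.HodgeConjecture.HodgeConjecture.Cruxes.HLiu418.K2LiuHermTwoXiIndefiniteContinuation

end
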